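import Summits.Schanuel.Schanuel.Theses.DiophantineDichotomy
import Literature.NumberTheory.Transcendental.QuadraticRelationsLogarithmsWeilHeight

/-!
# crux-plan `stmt-Schanuel-6118` / idea `ap2-liouville-descent` — NO SKELETON; corrected salvage

Planner `planner-cruxplan-stmt-Schanuel-6118-ap2-liouville-descen-0`, 2026-08-16.
Companion prose: `NoSkeletonAp2LiouvilleDescent.md` (the no-skeleton report, with the
derivations behind §4 below).

VERDICT. The idea `Ideas/ap2-liouville-descent.md` (crux-ideate r2, ideator 5; triage r2: pass /
FAIL(iv) / pass) runs the route's race BACKWARDS: `crux ∧ (printed AP2) ⟹ (π, e) has finite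
transcendence type`. Every arrow it proves LEAVES the crux; none arrives. A skeleton
`EPiSimultaneousType_of : stub₁ → ⋯ → stub_k → EPiSimultaneousType` built on this lever is
necessarily (a) SHRED — the descent stub takes the crux as hypothesis, so inside a composition
concluding the crux it can only sit as an idle hypothesis; (b) COSTUME — its output
`PolyPairType(E₁ > 1)` (§2) does not transfer back: a type-`(E₁, E₂)` measure fed through the
Siegel window gives `log(1/dist) ≲ (log H)^{E₁}·d^{…}`, never the crux's LINEAR-in-`log H` shape,
so any stub "`PolyPairType ∧ X → crux`" hides the whole crux in `X`; or (c) DUPLICATE — the only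
honest forward completion `MAI(η < 1, linear) ∧ (★) → crux` is the registered line
`Lines/compositum-defect-split.lean` / card `siegel-window-transfer`. §4 records the one forward
reading of the lever I could find (promote `RaceReverse`'s conclusion to a hypothesis: a DEGREE
FLOOR for Philippon-quality points) and why it is not a line either: it closes the crux only on
bounded index (`a = 1/κ`; there it IS the crux in Philippon's currency) and meets round 1's e-side
gap off it. Hence `no-skeleton`; the card's mathematics is negative-side / pricing material, filed
here in CORRECTED form (triage r2-1 (i), r2-2 (A3), r2-3 "sharpen (mandatory)").

CONTENTS (statements are `def … : Prop`; the four `theorem`s are pure logic, sorry-free):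
* §0 crux vocabulary (verbatim copy of `Disproof.lean` §0 / `SketchIdeator5.lean`: `theta`,
  `Admissible`, `bound`, `MeasureAt`, `crux_iff`), `fieldOf`, `degOf`, `IsAP2Point`, `AP2At`.
* §1 `RaceReverse` — UNCHANGED (triage ×3: correct, provable now, M-sized). Destination: the
  Negative lane (`Theorems/EPiSimultaneousType/Negative/RaceReverse.lean`, conclusion does not
  assert a Theses decl) or `Disproof.lean` §3 next to `race`: "if the crux holds, every AP2-quality
  approximant of `(π, e)` at scale `(Δ, Y)` has degree `≥ min((Δ/4cC)^{1/a}, (Y/4cC)^{1/(b−1)})`" —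
  a constraint every refuting family must meet.
* §2 `PolyPairTypeOff` (finite type AWAY FROM THE RELATION IDEAL: only `Q` with `Q(θ) ≠ 0`) and
  the corrected descents `AP2DescentOff`, `AP2DescentOffExplicit` — provable by the card's argument
  as written (IdeatorK5Notes §D5(2); re-derived by all three triagers). The unrestricted
  `PolyPairType` is recovered only with `NoIntegerRelation` (= `e ⊥ π` over `ℤ[x, y]`) as an extra
  hypothesis: `polyPairType_iff`, `ap2DescentOfIndep_of_off` (proved); inside the route
  `NoIntegerRelation` comes from `Disproof.epiRace_kernel` (crux ∧ Laurent–Roy level 1) via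
  `noIntegerRelation_of_indep` (proved). `EPiRaceViaAP2` ("e ⊥ π from crux ∧ AP2 with NO level-1
  input") is WITHDRAWN: AP2 ∧ crux are jointly consistent on a putative ℚ-curve through `(π, e)` for
  every `a ∈ [1/2, 1)` (triage r2-2 A3 / r2-3 THE GAP).
* §3 `SmallNonzeroValues` + `not_crux_of_smallNonzeroValues` (proved): the kill shape for the
  standing disprover's `-- Targets`, CORRECTED — the witnesses are NON-ZERO small values (as every
  computed PSLQ/LLL value is), so the restricted descent suffices and no level-1 / `e ⊥ π` input is
  needed (pace triage r2-2 salvage (2), which asked for "AP2 ∧ level-1").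
* §4 `DegFloor`, `IndexLE`, `CoreMeasureAt`, `DegFloorCoreTransfer`, `DegFloorOffCoreGap`
  (statements only): the forward reading and its limits, for the next ideation round's dead-line
  list.

Imports as `SketchIdeator5.lean` (route file + `weilHeight₁`). Not a line; not registered.
-/

set_option linter.dupNamespace false
set_option linter.unusedVariables false

namespace Summit.Schanuel.Schanuel.Cruxes.EPiSimultaneousType.AP2DescentSalvage

open Summit.Schanuel.Schanuel.Theses.DiophantineDichotomy
open Literature.NumberTheory.Transcendental
open MvPolynomial
open scoped IntermediateField

noncomputable section

/-! ## §0 Vocabulary (verbatim from `Disproof.lean` §0 / `SketchIdeator5.lean`) -/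

/-- `θ = (π, e)`, exactly as in the route file. -/
def theta : Fin 2 → ℂ := ![(Real.pi : ℂ), (Real.exp 1 : ℂ)]

/-- The admissibility clause of the crux for `(d, H, γ)`. -/
def Admissible (d H : ℕ) (γ : Fin 2 → ℂ) : Prop :=
  Module.finrank ℚ ↥(IntermediateField.adjoin ℚ (Set.range γ)) ≤ d ∧
    ∀ i, ∃ P : Polynomial ℤ, P ≠ 0 ∧ P.natDegree ≤ d ∧ (∀ k, |P.coeff k| ≤ (H : ℤ)) ∧
      Polynomial.aeval (γ i) P = 0

/-- The crux's lower bound `exp(−C(dᵃ log H + dᵇ))`. -/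
def bound (a b C : ℝ) (d H : ℕ) : ℝ :=
  Real.exp (-(C * ((d : ℝ) ^ a * Real.log H + (d : ℝ) ^ b)))

/-- A simultaneous approximation measure of the crux's shape at `ϑ`. -/
def MeasureAt (ϑ : Fin 2 → ℂ) (a b C : ℝ) : Prop :=
  ∀ (d H : ℕ) (γ : Fin 2 → ℂ), Admissible d H γ → bound a b C d H ≤ ‖γ - ϑ‖

/-- READ-BACK: the crux is `∃ a < 1, b, C > 0, MeasureAt θ a b C`. [folklore] -/
theorem crux_iff : EPiSimultaneousType ↔ ∃ a b C : ℝ, a < 1 ∧ 0 < C ∧ MeasureAt theta a b C := by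
  simp only [EPiSimultaneousType, MeasureAt, Admissible, bound, theta, and_imp]

/-- The number field `ℚ(α)` of a point `α ∈ ℂ²`. -/
def fieldOf (α : Fin 2 → ℂ) : IntermediateField ℚ ℂ := IntermediateField.adjoin ℚ (Set.range α)

/-- `[ℚ(α):ℚ]` as a real number (`0` for a transcendental point — excluded wherever used). -/
def degOf (α : Fin 2 → ℂ) : ℝ := (Module.finrank ℚ ↥(fieldOf α) : ℝ)

/-- "`α` is an approximant of `θ` of PHILIPPON (AP2) QUALITY at scale `(Δ, Y)` with constant `c`":
algebraic coordinates, `[ℚ(α):ℚ] ≤ (cΔ)²`, `[ℚ(α):ℚ]·h(1:α₁:α₂) ≤ c²YΔ` (absolute log Weil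
height of the POINT, tree `weilHeight₁` — the printed AP2 bounds exactly this product, LNM 1752
Ch. 4 §4 p. 50 "`d(α)h(α) ≤ c'(n)ⁿ·HΔ^{n−1}`", checked on the page by triage r2-1/2/3), and
`‖α − θ‖ ≤ exp(−[ℚ(α):ℚ]·(h(α)Δ + Y)/c)`. -/
def IsAP2Point (c Δ Y : ℝ) (α : Fin 2 → ℂ) : Prop :=
  (∀ i, IsAlgebraic ℚ (α i)) ∧ degOf α ≤ (c * Δ) ^ 2 ∧
    degOf α * weilHeight₁ (fieldOf α) α ≤ c ^ 2 * Y * Δ ∧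
    ‖α - theta‖ ≤ Real.exp (-(degOf α * (weilHeight₁ (fieldOf α) α * Δ + Y) / c))

/-- **Philippon's approximation property 2 at `θ = (π, e)`** (PRINTED THEOREM for `n = 2`:
Nesterenko–Philippon LNM 1752 Ch. 4 §4 p. 50 = PDF p. 61; Philippon, JNT 81 (2000)
doi:10.1006/jnth.1999.2461, acq-02318; affine shadow at `x = (1 : π : e)`, `θ`-dependent `c`;
to be vendored as a Literature named fact). -/
def AP2At : Prop :=
  ∃ c : ℝ, 1 ≤ c ∧ ∀ Δ Y : ℝ, c ≤ Δ → c * Δ ≤ Y → ∃ α : Fin 2 → ℂ, IsAP2Point c Δ Y α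

/-! ## §1 The race in reverse (unchanged; Negative-lane material) -/

/-- **`RaceReverse`** (the card's first lemma; triage r2 ×3: correct; provable now, M-sized): a
crux-shaped measure with `0 < a < 1 < b` forces every Philippon-quality approximant at scale
`(Δ, Y)`, `Y ≥ Δ ≥ Δ₀`, to have degree `≥ min((Δ/4cC)^{1/a}, (Y/4cC)^{1/(b−1)})`. Proof: unfold
the measure at the admissible datum of `α` (level `[ℚ(α):ℚ]`, the characteristic polynomials of
the coordinates, naive log-height `≤ [ℚ(α):ℚ](h(α) + log 2)`), then absorb. For `a < 1/2` it
degenerates into `Disproof.not_crux_half_of_weakAP2`; for `a ≥ 1/2` it is information. As a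
NEGATIVE lemma: any refuting family of `(π, e)`-approximants of AP2 quality must have degrees
`< (Δ/4cC)^{1/a}` at its scales. -/
def RaceReverse : Prop :=
  ∀ (a b C c : ℝ), 0 < a → a < 1 → 1 < b → 0 < C → 1 ≤ c → MeasureAt theta a b C →
    ∃ Δ₀ : ℝ, ∀ (Δ Y : ℝ) (α : Fin 2 → ℂ), Δ₀ ≤ Δ → Δ ≤ Y → IsAP2Point c Δ Y α →
      min ((Δ / (4 * c * C)) ^ (1 / a)) ((Y / (4 * c * C)) ^ (1 / (b - 1))) ≤ degOf α

/-! ## §2 Finite type away from the relation ideal (the corrected descent) -/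

/-- UNRESTRICTED finite transcendence type of `(π, e)` (size exponent `E₁`, degree exponent `E₂`):
`|Q(π, e)| ≥ exp(−C(log Hq + deg Q + 1)^{E₁}(deg Q + 1)^{E₂})` for ALL non-zero `Q ∈ ℤ[x, y]` with
coefficients bounded by `Hq ≥ 2`. CONTAINS `e ⊥ π` (`polyPairType_iff`): NOT a consequence of
`crux ∧ AP2` by the card's mechanism (triage r2: the gap at `Q(θ) = 0`). -/
def PolyPairType (E₁ E₂ C : ℝ) : Prop :=
  ∀ (Q : MvPolynomial (Fin 2) ℤ) (Hq : ℕ), Q ≠ 0 → 2 ≤ Hq → (∀ m, |Q.coeff m| ≤ (Hq : ℤ)) →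
    Real.exp (-(C * ((Real.log Hq + Q.totalDegree + 1) ^ E₁ * ((Q.totalDegree : ℝ) + 1) ^ E₂)))
      ≤ ‖aeval theta Q‖

/-- **Finite type AWAY FROM THE RELATION IDEAL** (triage r2-3 "sharpen (mandatory)", r2-1 (i),
r2-2 (A3)): the same bound, demanded only of `Q` with `Q(π, e) ≠ 0`. THIS is what the descent
proves from `crux ∧ AP2`: for such `Q` the value `λ = −log|Q(θ)|` is finite, the least admissible
scale `Δ₁` with `L(Δ₁) > λ` exists, Liouville at the single AP2 point `α` (one height factor:
`d(α)(h(Q) + 2·deg Q·h(α))`) forces `Q(α) ≠ 0 ⇒ λ ≤ B(Δ₁)`, and the self-improvement gives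
`(E₁, E₂) = (1 + 2/(q + 1/a − 2), max(q + 2, (aq + 1)/(1 − a)))`. -/
def PolyPairTypeOff (E₁ E₂ C : ℝ) : Prop :=
  ∀ (Q : MvPolynomial (Fin 2) ℤ) (Hq : ℕ), Q ≠ 0 → aeval theta Q ≠ 0 → 2 ≤ Hq →
    (∀ m, |Q.coeff m| ≤ (Hq : ℤ)) →
    Real.exp (-(C * ((Real.log Hq + Q.totalDegree + 1) ^ E₁ * ((Q.totalDegree : ℝ) + 1) ^ E₂)))
      ≤ ‖aeval theta Q‖

/-- No non-zero integer polynomial relation between `π` and `e` (= algebraic independence of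
`(e, π)`, in the `ℤ[x, y]`-currency of this file; `noIntegerRelation_of_indep`). -/
def NoIntegerRelation : Prop :=
  ∀ Q : MvPolynomial (Fin 2) ℤ, Q ≠ 0 → aeval theta Q ≠ 0

/-- **The corrected descent** (provable now modulo vendoring AP2; L-sized; ingredients:
`RaceReverse`, Liouville for `Q(α) ∈ ℚ(α)` — tree `Roy2013.orbit_liouville` /
`AlgGens.one_le_norm_mul_house_pow` —, the mean-value bound `‖∇Q‖ ≤ exp(h + 3δ + 2 log(δ+2))` on
the segment, scales `Y = Δ^q`). -/
def AP2DescentOff : Prop :=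
  AP2At → EPiSimultaneousType → ∃ E₁ E₂ C : ℝ, 1 < E₁ ∧ 0 < C ∧ PolyPairTypeOff E₁ E₂ C

/-- Explicit-exponent form of the corrected descent (what a prover would prove; every inequality
is listed in `IdeatorK5Notes.md` §D5 and re-derived in TRIAGE-r2-1 (details), r2-2 (A2),
r2-3 (details)). -/
def AP2DescentOffExplicit : Prop :=
  AP2At → RaceReverse → ∀ (a b C q : ℝ), 1 / 2 ≤ a → a < 1 → 1 < b → 0 < C →
    max 2 ((b - 1) / a) ≤ q → MeasureAt theta a b C →
      ∃ C' : ℝ, 0 < C' ∧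
        PolyPairTypeOff (1 + 2 / (q + 1 / a - 2)) (max (q + 2) ((a * q + 1) / (1 - a))) C'

/-- The unrestricted descent, correctly sourced: it needs `NoIntegerRelation` (inside the route:
`Disproof.epiRace_kernel`, i.e. crux ∧ Laurent–Roy level 1, then `noIntegerRelation_of_indep`). -/
def AP2DescentOfIndep : Prop :=
  AP2At → EPiSimultaneousType → NoIntegerRelation →
    ∃ E₁ E₂ C : ℝ, 1 < E₁ ∧ 0 < C ∧ PolyPairType E₁ E₂ C

/-- Unrestricted type = restricted type + no relation (pure logic; the `→ NoIntegerRelation` half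
is the ideator's `no_integer_relation_of_polyPairType`). [folklore] -/
theorem polyPairType_iff (E₁ E₂ C : ℝ) :
    PolyPairType E₁ E₂ C ↔ PolyPairTypeOff E₁ E₂ C ∧ NoIntegerRelation := by
  constructor
  · intro h
    refine ⟨fun Q Hq hQ _ hHq hco => h Q Hq hQ hHq hco, fun Q hQ h0 => ?_⟩
    obtain ⟨Hq, hHq2, hcoeff⟩ : ∃ Hq : ℕ, 2 ≤ Hq ∧ ∀ m, |Q.coeff m| ≤ (Hq : ℤ) := by
      refine ⟨(Q.support.sup fun m => (Q.coeff m).natAbs) + 2, by omega, fun m => ?_⟩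
      by_cases hm : m ∈ Q.support
      · have h1 : (Q.coeff m).natAbs ≤ Q.support.sup fun m => (Q.coeff m).natAbs :=
          Finset.le_sup (f := fun m => (Q.coeff m).natAbs) hm
        have h2 : |Q.coeff m| = ((Q.coeff m).natAbs : ℤ) := (Int.natCast_natAbs _).symm
        rw [h2]; push_cast; omega
      · rw [MvPolynomial.notMem_support_iff.mp hm]; simp
        positivity
    have := h Q Hq hQ hHq2 hcoeff
    rw [h0, norm_zero] at this
    exact absurd this (not_le.mpr (Real.exp_pos _))
  · rintro ⟨hoff, hno⟩ Q Hq hQ hHq hco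
    exact hoff Q Hq hQ (hno Q hQ) hHq hco

/-- The correctly sourced unrestricted descent follows from the restricted one. [folklore] -/
theorem ap2DescentOfIndep_of_off (h : AP2DescentOff) : AP2DescentOfIndep := by
  intro hAP hcrux hno
  obtain ⟨E₁, E₂, C, h1, hC, hoff⟩ := h hAP hcrux
  exact ⟨E₁, E₂, C, h1, hC, (polyPairType_iff E₁ E₂ C).mpr ⟨hoff, hno⟩⟩

/-- `e ⊥ π` (as concluded by the route's `EPiRace` / `Disproof.epiRace_kernel`) gives
`NoIntegerRelation`: swap the variables, pass from `ℤ`- to `ℚ`-coefficients and from `ℝ` to `ℂ`.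
[folklore] -/
theorem noIntegerRelation_of_indep (hind : AlgebraicIndependent ℚ ![Real.exp 1, Real.pi]) :
    NoIntegerRelation := by
  intro Q hQ h0
  apply hQ
  let s : Fin 2 → Fin 2 := ![1, 0]
  have hsinj : Function.Injective s := by decide
  set Q' : MvPolynomial (Fin 2) ℚ := MvPolynomial.map (algebraMap ℤ ℚ) (MvPolynomial.rename s Q)
    with hQ'
  let φ : ℝ →ₐ[ℚ] ℂ := Complex.ofRealAm.restrictScalars ℚ
  have hφ : Function.Injective φ := Complex.ofReal_injective
  have heval : φ (aeval ![Real.exp 1, Real.pi] Q') = aeval theta Q := by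
    have h1 := AlgHom.congr_fun (MvPolynomial.comp_aeval ![Real.exp 1, Real.pi] φ) Q'
    rw [AlgHom.comp_apply] at h1
    rw [h1]
    have h2 : (fun i => φ (![Real.exp 1, Real.pi] i)) = theta ∘ s := by
      ext i
      fin_cases i <;> simp [φ, theta, s]
    rw [h2, hQ', MvPolynomial.aeval_map_algebraMap, MvPolynomial.aeval_rename]
    have hss : (theta ∘ s) ∘ s = theta := by
      funext i
      fin_cases i <;> rfl
    rw [hss]
  have hzero : aeval ![Real.exp 1, Real.pi] Q' = 0 := by
    apply hφ
    rw [heval, h0, map_zero]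
  have hinj : Function.Injective (aeval ![Real.exp 1, Real.pi] : MvPolynomial (Fin 2) ℚ →ₐ[ℚ] ℝ) :=
    algebraicIndependent_iff_injective_aeval.mp hind
  have hQ'0 : Q' = 0 := hinj (hzero.trans (map_zero _).symm)
  have hren : MvPolynomial.rename s Q = 0 := by
    apply MvPolynomial.map_injective (algebraMap ℤ ℚ) (algebraMap ℤ ℚ).injective_int
    rw [← hQ', hQ'0, map_zero]
  exact MvPolynomial.rename_injective s hsinj (hren.trans (map_zero _).symm)

/-! ## §3 The kill shape for `-- Targets` (corrected: NON-ZERO small values) -/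

/-- "`(π, e)` has non-zero integer polynomial values that are small beyond EVERY finite type":
for each `E` a non-zero `Q ∈ ℤ[x, y]`, coefficients `≤ Hq` (`Hq ≥ 2`), with
`0 < |Q(π, e)| < exp(−E(log Hq + deg Q + 1)^E(deg Q + 1)^E)`. (The PSLQ/LLL-searchable currency;
not expected — generically `|Q(π, e)| ≈ exp(−(deg Q)²/2·log Hq)`, kit j011602; an infinite family,
so never certifiable by one computation: the kill route is nominal, triage r2-3 (ii).) -/
def SmallNonzeroValues : Prop :=
  ∀ E : ℝ, ∃ (Q : MvPolynomial (Fin 2) ℤ) (Hq : ℕ), Q ≠ 0 ∧ 2 ≤ Hq ∧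
    (∀ m, |Q.coeff m| ≤ (Hq : ℤ)) ∧ 0 < ‖aeval theta Q‖ ∧
      ‖aeval theta Q‖ < Real.exp (-(E * ((Real.log Hq + Q.totalDegree + 1) ^ E *
        ((Q.totalDegree : ℝ) + 1) ^ E)))

/-- **Kill shape** (pure logic given the corrected descent and the printed AP2): non-zero small
values beyond every finite type refute the crux — NO level-1 / `e ⊥ π` input needed, because the
witnesses are non-zero. [folklore] -/
theorem not_crux_of_smallNonzeroValues (hsmall : SmallNonzeroValues) (hAP : AP2At)
    (hdesc : AP2DescentOff) : ¬ EPiSimultaneousType := by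
  intro hcrux
  obtain ⟨E₁, E₂, C, -, hC, hmeas⟩ := hdesc hAP hcrux
  set m : ℝ := max 1 (max E₁ (max E₂ C)) with hm
  obtain ⟨Q, Hq, hQ0, hHq, hcoeff, hpos, hlt⟩ := hsmall m
  have hne : aeval theta Q ≠ 0 := by
    intro h0
    rw [h0, norm_zero] at hpos
    exact lt_irrefl _ hpos
  have hle := hmeas Q Hq hQ0 hne hHq hcoeff
  have hlog : 0 ≤ Real.log Hq := Real.log_natCast_nonneg Hq
  have hdeg : (0 : ℝ) ≤ (Q.totalDegree : ℝ) := by positivity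
  have hS1 : (1 : ℝ) ≤ Real.log Hq + Q.totalDegree + 1 := by linarith
  have hD1 : (1 : ℝ) ≤ (Q.totalDegree : ℝ) + 1 := by linarith
  have h1m : (1 : ℝ) ≤ m := le_max_left _ _
  have hE1m : E₁ ≤ m := le_trans (le_max_left _ _) (le_max_right _ _)
  have hE2m : E₂ ≤ m :=
    le_trans (le_trans (le_max_left _ _) (le_max_right _ _)) (le_max_right _ _)
  have hCm : C ≤ m :=
    le_trans (le_trans (le_max_right _ _) (le_max_right _ _)) (le_max_right _ _)
  have hA : (Real.log Hq + Q.totalDegree + 1) ^ E₁ ≤ (Real.log Hq + Q.totalDegree + 1) ^ m :=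
    Real.rpow_le_rpow_of_exponent_le hS1 hE1m
  have hB : ((Q.totalDegree : ℝ) + 1) ^ E₂ ≤ ((Q.totalDegree : ℝ) + 1) ^ m :=
    Real.rpow_le_rpow_of_exponent_le hD1 hE2m
  have hApos : 0 ≤ (Real.log Hq + Q.totalDegree + 1) ^ E₁ := by positivity
  have hBpos : 0 ≤ ((Q.totalDegree : ℝ) + 1) ^ m := by positivity
  have key : C * ((Real.log Hq + Q.totalDegree + 1) ^ E₁ * ((Q.totalDegree : ℝ) + 1) ^ E₂)
      ≤ m * ((Real.log Hq + Q.totalDegree + 1) ^ m * ((Q.totalDegree : ℝ) + 1) ^ m) := by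
    have hCpos : 0 ≤ C := hC.le
    calc C * ((Real.log Hq + Q.totalDegree + 1) ^ E₁ * ((Q.totalDegree : ℝ) + 1) ^ E₂)
        ≤ C * ((Real.log Hq + Q.totalDegree + 1) ^ E₁ * ((Q.totalDegree : ℝ) + 1) ^ m) := by
          gcongr
      _ ≤ C * ((Real.log Hq + Q.totalDegree + 1) ^ m * ((Q.totalDegree : ℝ) + 1) ^ m) := by
          gcongr
      _ ≤ m * ((Real.log Hq + Q.totalDegree + 1) ^ m * ((Q.totalDegree : ℝ) + 1) ^ m) := by
          gcongr
  have hexp : Real.exp (-(m * ((Real.log Hq + Q.totalDegree + 1) ^ m *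
        ((Q.totalDegree : ℝ) + 1) ^ m)))
      ≤ Real.exp (-(C * ((Real.log Hq + Q.totalDegree + 1) ^ E₁ *
        ((Q.totalDegree : ℝ) + 1) ^ E₂))) := by
    rw [Real.exp_le_exp]; linarith
  linarith [lt_of_le_of_lt (le_trans hexp hle) hlt]

/-! ## §4 The one forward reading of the lever, and why it is not a line (statements only)

Promote `RaceReverse`'s CONCLUSION to a hypothesis: a DEGREE FLOOR for every point of Philippon
quality (not only the ones AP2 produces). This is a genuine forward statement (`DegFloor κ ⟹` a
crux-shaped measure), and the report `NoSkeletonAp2LiouvilleDescent.md` §3 derives its exact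
reach: with `1 < κ ≤ 2` it yields the crux's inequality with `a = 1/κ` on challengers of INDEX
`≤ M` (`[ℚ(γ):ℚ] ≤ M·[ℚ(γᵢ):ℚ]`, `i = 1, 2`; constants depend on `M`) — because there the point
height satisfies `[ℚ(γ):ℚ]·h(γ) ≤ 2M(log H + log(d+1))` — and NOTHING more: off the core the
index `ι₂ = [ℚ(γ):ℚ(γ₂)]` can be `≍ d^{1−a/2}` after the printed `e`-measure (degree exponent 2)
has removed `deg γ₂ ≤ d^{a/2}`, and the scope condition `(ι₁ + ι₂)·r^{1/κ} ≲ C dᵃ` then needs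
`a ≥ (2/3)(1 + 1/κ) ≥ 1` — round 1's e-side gap verbatim (with an `e`-measure of exponent `ν` the
floor is `a ≥ (1 + 1/κ)/(1 + 1/ν)`: `3/4` at `κ = 2, ν = 1`, the Siegel lever's floor). On the core,
`DegFloor (1/a)` and the crux are the SAME statement up to constants (`RaceReverse` is the converse
there): Philippon's currency `(r, h(α))` versus the naive one `(d, log H)`, exchange rate = the index.
So this reading is card `bounded-index-core`'s cut with a point-measure input instead of a
codimension-one MAI — not this idea's lever, and costume-adjacent on the core. -/

/-- The TRUE degree `[ℚ(z):ℚ]` of a coordinate. -/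
def coordDeg (z : ℂ) : ℕ := Module.finrank ℚ ↥ℚ⟮z⟯

/-- Bounded entanglement index: `[ℚ(γ):ℚ] ≤ M·[ℚ(γᵢ):ℚ]` for both coordinates (the population
card `bounded-index-core` calls `Core M`; `EPiRace` only ever tests such challengers). -/
def IndexLE (M : ℕ) (γ : Fin 2 → ℂ) : Prop :=
  ∀ i, Module.finrank ℚ ↥(IntermediateField.adjoin ℚ (Set.range γ)) ≤ M * coordDeg (γ i)

/-- The crux's measure demanded only of challengers of index `≤ M`. -/
def CoreMeasureAt (M : ℕ) (ϑ : Fin 2 → ℂ) (a b C : ℝ) : Prop :=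
  ∀ (d H : ℕ) (γ : Fin 2 → ℂ), Admissible d H γ → IndexLE M γ → bound a b C d H ≤ ‖γ - ϑ‖

/-- **Degree floor for Philippon-quality points** (`RaceReverse`'s conclusion as a hypothesis,
with the `Y`-branch dropped): every algebraic `α` within `exp(−[ℚ(α):ℚ](h(α)Δ + Y)/c)` of `θ`
with `[ℚ(α):ℚ] ≤ (cΔ)²`, `[ℚ(α):ℚ]h(α) ≤ c²YΔ` has `[ℚ(α):ℚ] ≥ (Δ/K)^κ`. For `κ = 2` this says
"AP2 is optimal at `(π, e)`" — the generic truth, an approximation MEASURE of exponent `3/2` in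
`([ℚ(α):ℚ], h(α))`-currency (`log(1/‖α − θ‖) ≲ K'·[ℚ(α):ℚ]^{3/2}(h(α) + 1)`); it contains `e ⊥ π`
(Laurent–Roy on-curve points have quality `≍ d²h`). -/
def DegFloor (κ K c Δ₀ : ℝ) : Prop :=
  ∀ (Δ Y : ℝ) (α : Fin 2 → ℂ), Δ₀ ≤ Δ → Δ ≤ Y → (∀ i, IsAlgebraic ℚ (α i)) →
    degOf α ≤ (c * Δ) ^ 2 → degOf α * weilHeight₁ (fieldOf α) α ≤ c ^ 2 * Y * Δ →
    ‖α - theta‖ ≤ Real.exp (-(degOf α * (weilHeight₁ (fieldOf α) α * Δ + Y) / c)) →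
      (Δ / K) ^ κ ≤ degOf α

/-- **The forward reading reaches exactly the bounded-index core** (derivation in the report §3;
provable now, M-sized, NOT filed as a stub — it is the crux re-worded on the core): `DegFloor κ`
with `1 < κ ≤ 2` gives the crux's inequality with `a = 1/κ`, `b = 1 + 1/κ`, `C = C(M, K, c, Δ₀)`
on index `≤ M`. Scale choice: `Δ = max(Δ₀, K r^{1/κ} + 1)`, `Y = max(Δ, r h/(c²Δ))`,
`r = [ℚ(γ):ℚ]`; scope: `r h(γ) ≤ (ι₁ + ι₂)(log H + log(d+1)) ≤ 2M(log H + log(d+1))`. -/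
def DegFloorCoreTransfer : Prop :=
  ∀ (κ K c Δ₀ : ℝ) (M : ℕ), 1 < κ → κ ≤ 2 → 1 ≤ K → 1 ≤ c → DegFloor κ K c Δ₀ →
    ∃ C : ℝ, 0 < C ∧ CoreMeasureAt M theta (1 / κ) (1 + 1 / κ) C

/-- **…and no further with printed single-variable input** (the e-side gap of round 1, in this
currency; recorded as the dead step for the next ideation round): the conjunction of `DegFloor 2`,
the printed `π`-measure (degree exponent `1 + o(1)`) and the printed `e`-measure (degree exponent
`2`) is NOT known to give `MeasureAt θ a b C` for any `a < 1` — the uncovered challengers are those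
with `deg γ₂ ∈ (d^{a/2}, d^{3/2 − a})`, `ι₂ = [ℚ(γ):ℚ(γ₂)] → ∞`. Stated as the implication one
would NEED (expected unprovable by this mechanism; do not file). -/
def DegFloorOffCoreGap : Prop :=
  ∀ (K c Δ₀ : ℝ), 1 ≤ K → 1 ≤ c → DegFloor 2 K c Δ₀ →
    ∃ a b C : ℝ, a < 1 ∧ 0 < C ∧ MeasureAt theta a b C

end

end Summit.Schanuel.Schanuel.Cruxes.EPiSimultaneousType.AP2DescentSalvage
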